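import Mathlib.Data.Rat.Defs

/-!
# GridStability/Models/StructurePreservingTableTree — closed search-tree table literals («ARCH-4», Q4′ «ENCODING-CURE»)

LADDER-GRIDFUSION G2-SCALE cell, DIRECTOR RULING 84 (Q4′ = the statement-preserving encoding cure measured by
gridfusion-g2-crit-1 g2, k-CHECK 3/3 (β), STATUS 2026-08-28T21:52:29Z): the instance emitter
(`cert/sos-2/sp/gen_sp_models_lean.py --vec bt`, gridfusion-sos-2) types every data table `X : Fin n → τ` of a
structure-preserving instance module as a CLOSED balanced search tree `XT : BT τ` (split keys = interval midpoints,
leaves in index order) together with `X := fun i => XT.look i.val`.  Because the index is NOT threaded through the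
data term, a kernel unfolding of `X i` walks one root-to-leaf path (depth ⌈log₂ n⌉) and copies nothing — the
λ-threaded balanced-if encoding of ARCH-2/3 (`fun i => if i.val < K then … else …`) β-instantiates the whole n-leaf
body at every lookup (Θ(n) per lookup, crit-1 k-CHECK 2/3).  Generic, instance-free; no statement about any grid.
Three columns: CERTIFIED — nothing (a data structure and its lookup); VALIDATED — n/a; MODELLED — n/a.
-/

namespace Summit.Ventures.GridStability.Models.StructurePreserving

/-- A closed binary search tree over values of type `α`: `leaf a` holds one table entry, `node K l r` sends indices
`k < K` to the left subtree `l` and `k ≥ K` to the right subtree `r`.  The emitter builds it balanced over the index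
interval `[0, n)` with `K` = the interval midpoint, leaves in index order. [folklore] -/
inductive BT (α : Type) where
  | leaf : α → BT α
  | node : ℕ → BT α → BT α → BT α

/-- Table lookup: follow the split keys from the root to a leaf (`k < K` ⇒ left, else right) and return the leaf's
value; structural recursion on the tree, so `decide +kernel` unfolds exactly one path. [folklore] -/
def BT.look {α : Type} (k : ℕ) : BT α → α
  | .leaf a => a
  | .node K l r => if k < K then BT.look k l else BT.look k r

/-- `look` on a leaf returns its value (definitional unfolding, stated for readers of the emitted tables). [folklore] -/
theorem BT.look_leaf {α : Type} (k : ℕ) (a : α) : (BT.leaf a).look k = a := rfl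

/-- `look` on a node descends left iff the index is below the split key. [folklore] -/
theorem BT.look_node {α : Type} (k K : ℕ) (l r : BT α) :
    (BT.node K l r).look k = if k < K then l.look k else r.look k := rfl

end Summit.Ventures.GridStability.Models.StructurePreserving
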